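import Literature.MathematicalPhysics.QuantumFieldTheory.Balaban1983to89.Node00.Record13SepCoPInhabitedOfThm1CCMWGaugeRSignFree

/-!
# NODE 00 (YM-PLAN Track A) — STAGE 13: THE K0 BODIES AT `θ₁₅ᶜᶜᴹ(j; γ)` ON EVERY FAMILY — the non-wrapping binder `hsN` of the gauge road DERIVED from row `bg`'s own
# guards (the window `]0, ½]` and `PartCompat₁₃`), so that the closers ⁵ ∕ ⁷ and the cube instance carry NO `j + 1 ≤ F.m` ∕ `4 ≤ F.m` — STAGE-2 EDITION AT PRINT's (2.3) DATUM
# (tokens `…7MGB ∕ …StepGB … (floorGuard F c) (lamDatum F) (dataSmall7PTopOf F N) …`, §2 background-generic over `(Adm, bd, Dat, Ubg, hbg)`)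

Seat `pub-ymgap-dag-n21-c` (g13), lineage of A1ʷ∕A2ʷ∕Bʷ∕Eʷ (`Node00/Record13{Numerics,Letters}OfThm1CCMW`, `…SepCoPInhabitedOfThm1CCMWGaugeR{,SignFree}`) and of B′
(`Node00/Record12BgRowCoClassGaugeR`).  Answer, in kernel, to plan g77's STANDING QUESTION (pub-ymgap bus 2026-08-27 l.23344 (A), «is any DISPLAYED row of the ⁷ body
UNSATISFIABLE at a wrapping family `F.m ≤ 3`?») and to director-ym №195 (1) («a by-name proof of stub 4 remains welcome»).
[III] = [Balaban1988Convergent]; [I] = [Balaban1987RG1]; [15] = [Balaban1985Variational]; [6] = [Balaban1985RegularSpaces]; [14] = [Balaban1984PropagatorsII].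

STAGE-2 RE-KEY (node00-def-T g25, S1d CHAIN B4 by node00-def-K0a's assignment ∕ recipe, director-ym №346 ∕ №352): (E1) Stage-2 coherence re-key to print's (2.3) datum (FLAG №16 ∕ LOCATE-HSEAM
5d3298b8d191f169); the (b)-keyed text survives in git history.  §0 ∕ §1 are BYTE-IDENTICAL (k0-s1-w1's `Record12BgRowCoClassGaugeRGuardedBRowAllTorus` ∕ `…BRowLam` and
`Thm/…K0AllTorusOfStepTokensGuarded` read §1 by name).  §2 is now `Record12BgRowCoClassGaugeRGuardedBRow` §3's reduction over `(Adm, bd, Dat)` with the background `Ubg` GENERIC (entering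
through its `bd`-spec dichotomy `hbg`) and `hsN` derived — same decl name; §3 ∕ §4 display the GUARDED `(bd, Dat)` ᴮ tokens at `(floorGuard F c, lamDatum F, dataSmall7PTopOf F N)`: (8)
`VariationalThm1RegSepCoP7MGB F N (floorGuard F c) (lamDatum F) (dataSmall7PTopOf F N) B₃ a₀ a₁`, (9) `VariationalThm1GaugeRegSepCoP7MGB F N (F.L ^ j) (floorGuard F c) (lamDatum F)
(dataSmall7PTopOf F N) B₃ B₃' a₀ a₁`, step `Gauge9RegSepTopStepGB F N suppDom (F.L ^ j) (floorGuard F c) (lamDatum F) (dataSmall7PTopOf F N) B₃ B₃' a₀ a₁` (cube: `floorGuard F ((11·4 + 3·L)·L)`;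
supplier `variationalThm1GaugeRegSepCoP7MGB_of_gauge9TopStepGB`), and at level `n+1` the carrier `UbgOfRecord₁₃CoP_succ` IS node00-def-R's `UbgMSCoPOfRecordB …` at print's datum [14] (2.3)
(`LargeFieldBackgroundCoPOfRecordB`, Stage-2 seam edit of `Record13CoP`), §2 instantiated at `Ubg := UbgMSCoPOfRecordB …`, `hbg := ubgMSCoPOfRecordB_dichotomy …`, guard `c ≤ M₁ = L^j` from
`hc`.  Declaration NAMES unchanged; «(8) ∕ the R gauge sentence ∕ the (R) step fact ∕ B′» below denote these ᴮ tokens ∕ `Record12BgRowCoClassGaugeRGuardedB{,Row}`.  Re-keying bookkeeping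
only — nothing of Bałaban asserted.

THE FINDING (located, then typed).  Row `bg` of `Provisos₁₃SepCoPH` reads a localization domain `X ∈ 𝐃_j` only for `1 ≤ j ≤ n` at a run `(p, n)` that (a) stays in the window
`Step.InInterval θ.γ n (gOfRecord₁₃ θ p)` and (b) has torus-compatible 𝐃-partitions `PartCompat₁₃ θ p n` ([III] p. 257: `L^j·M·R_j ∣ 2·L^{m+K}` for `1 ≤ j ≤ n`).  In the window
`γ ≤ ½` every `R_j` of (2.5) is a positive multiple of `L` (K0a's letter (C1), A2ʷ `hC1_theta13OfThm1CCMW`), and `M = L^a` (row `hM`), `L` odd (`T4Family.hL`); hence (b) forces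
`j + a + 1 ≤ m + K`, i.e. the [I] (1.12) cube of level `n' ≤ n + 1` has side `L^{n'}·M ≤ L^{m+K}` — HALF the torus period `2·L^{m+K}`.  So the non-wrapping binder `hsN` of B′'s
`Stage13Params.bgAtDatumCoP_of_thm1RegSepCoP7M_of_thm1GaugeR` (demanded there for EVERY `n ≤ p.K`, whence A2's `hsN_theta13OfThm1CCM_iff : hsN ↔ j + 1 ≤ F.m` and the (δ) residual
`stub_k0SmallTorus13`) is OVER-STRENGTH relative to the row: at the guarded `(p, n)` it HOLDS ON EVERY FAMILY, wrapping or not (`Stage13Params.hsN_of_partCompat₁₃`).  The torus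
holonomy obstruction of the unguarded gauge sentence (dag-n21-c g10 `K0VariationalThm1GaugeWrap.exists_wrap_witness_top`) never meets row `bg`.

WHAT THIS FILE PROVES (0 `def`, 0 `sorry`):
§0 (private) `le_of_pow_dvd_two_mul_pow` — `L` odd, `1 < L`, `L^e ∣ 2·L^f ⟹ e ≤ f`.
§1 ★ `Stage13Params.hsN_of_partCompat₁₃` — for any Stage-13 parameter with `τ9.M = L^a`, at `1 ≤ n`: `PartCompat₁₃ θ p n` + (C1) up to `n` ⟹ `side L M n' < sitesPerDir 0` for
   `1 ≤ n' ≤ n + 1` (the binder B′ consumes, at that `(p, n)`).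
§2 ★★ `Stage13Params.bgAtDatumCoP_of_thm1RegSepCoP7M_of_thm1GaugeR_allTorus` — `Record12BgRowCoClassGaugeRGuardedBRow` §3's Stage-13 reduction over `(Adm, bd, Dat)`, background `Ubg`
   generic with its dichotomy `hbg`, VERBATIM with the hypothesis `hsN` REPLACED by `∃ a, θ.τ9.M = F.L ^ a` (row `hM`'s letter); proof = its §2 row body at `n ≥ 1` with §1, and the
   empty window at `n = 0`.
§3 ★★★ `bgSepCoPAt_theta13OfThm1CCMW_of_thm1GaugeR_of_hcomp_allTorus` — Eʷ's ★★★ʷʰ WITHOUT `hjm : j + 1 ≤ F.m` (statement otherwise verbatim).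
§4 the closers WITHOUT `hjm`∕`hm`: `exists_k0SepCoP{,H}_thm1CCMW_of_thm1GaugeR_of_hcomp_allTorus`, `exists_k0SepCoPH_thm1CCMW_of_gauge9TopStepR_of_hcomp_allTorus{,_cube}`,
   `exists_k0SepCoPH_thm1CCMW_of_gauge9TopStepR_of_betaBoxSignFree_half_cube_allTorus` — the cube instance `j = 3`, `M = M₁ = L³`, floor `(11·4 + 3L)·L` now serves EVERY family
   (`T4Family.hm : 1 ≤ m` included), so the Summits-side composition needs stubs 1, 2, 3ᴬ only (dag-n21-c Cʷ″).

HONEST FRAMING.  Hypothesis threading + one arithmetic lemma; CONDITIONAL on the guarded (8) `VariationalThm1RegSepCoP7MGB` ([15] Thm 1, N07), the guarded gauge sentence ∕ step fact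
`…GaugeRegSepCoP7MGB` ∕ `Gauge9RegSepTopStepGB` ([15] Sect. F ∕ [6] Prop. 6, N07∕N05) and the two history clauses (hcomp) ∧ (hcompRev) (NODE O ∕ 3ᴬ) — all DISPLAYED, never asserted; nothing of Bałaban asserted or discharged; K0⁷
(stmt-QuantumFields-20541) NOT closed; counts unmoved (typed 28∕28 · discharged 5∕27); one finite 𝕋⁴ programme at fixed ε — NOT continuum ∕ ℝ⁴ ∕ OS ∕ mass gap ∕ Clay.
No `sorry`, `axiom`, `def`, `instance`, `notation`.
-/

noncomputable section

open MeasureTheory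
open scoped Matrix.Norms.L2Operator

namespace Literature.MathematicalPhysics.QuantumFieldTheory.Balaban1983to89.Node00

open T4Continuum B14.Eq218Concrete B15DeterminingSets FlowStep FlowStepRuns B12RegularSpaces111 B14RegularSpaces234

/-! ## §0. Arithmetic: an odd power dividing twice a power -/

/-- For `L` odd and `> 1`: `L^e ∣ 2·L^f` forces `e ≤ f` (the factor `2` of the torus period `2·L^{m+K}` is invisible to powers of `L`). [folklore] -/
private theorem le_of_pow_dvd_two_mul_pow {L e f : ℕ} (hodd : Odd L) (h1 : 1 < L) (h : L ^ e ∣ 2 * L ^ f) : e ≤ f := by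
  have hcop : Nat.Coprime (L ^ e) 2 := Nat.Coprime.pow_left e (Odd.coprime_two_right hodd)
  exact (Nat.pow_dvd_pow_iff_le_right h1).mp (hcop.dvd_of_dvd_mul_left h)

/-! ## §1. ★ The non-wrapping binder of the gauge road FROM row `bg`'s guards -/

section NonWrapping

variable {F : T4Family} {N : ℕ} [NeZero N]

/-- **★ THE NON-WRAPPING BINDER `hsN` AT A GUARDED RUN, ON EVERY FAMILY**: for a Stage-13 parameter with 𝐑-cube side `M = L^a` (row `hM`), at a length `1 ≤ n` whose 𝐃_j-partitions
are torus-compatible (`PartCompat₁₃ θ p n`, [III] p. 257) and whose radii `R_j`, `1 ≤ j ≤ n`, are positive multiples of `L` (K0a's letter (C1) — true in the window `]0, ½]` by (2.5)), every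
[I] (1.12) cube of level `1 ≤ n' ≤ n + 1` (side `L^{n'}·M` fine sites) is SHORTER than the torus period `2·L^{m+K}`: indeed `L^{j+a+1} ∣ 2·L^{m+K}` at `j = min n' n` gives
`n' + a ≤ m + K` (§0), so the side is at most `L^{m+K}`, half the period.  Whence B′'s binder `hsN` at that `(p, n)` — for ANY `F.m ≥ 1`.  DISPLAYED
guards: `1 ≤ n`, `PartCompat₁₃ θ p n`, the (C1) instance at `(p, n)` (the window `Step.InInterval θ.γ n …` enters ONLY through (C1): §2 instantiates it as `hC1 p n hn hw`), and
row `hM`'s letter `θ.τ9.M = F.L ^ a`; NOTHING of the torus (`F.m`, `p.K`) is hypothesised.  At `n = 0` the lemma says nothing (PartCompat is vacuous there, `partCompat₁₃_zero`) —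
§2 treats `n = 0` as the empty window of scales `1 ≤ j ≤ 0` (cf. def-R `bgProvisoΛ_of_eq_zero`).
[cite: Balaban1988Convergent, (2.1) p.254, (2.5) p.255, p.257; Balaban1987RG1, (0.1) p.251, (1.12) p.262] -/
theorem Stage13Params.hsN_of_partCompat₁₃ (θ : Stage13Params F N) {a : ℕ} (hMa : θ.τ9.M = F.L ^ a) {p : B12.RunParams} {n : ℕ} (hn1 : 1 ≤ n)
    (hpc : PartCompat₁₃ F N θ p n)
    (hC1 : ∀ j, 1 ≤ j → j ≤ n → ∃ t : ℕ, 0 < t ∧ RkOfRecord (F.P p.K).L θ.ν.r (gOfRecord₁₃ F N θ p j) = (F.P p.K).L * t) :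
    ∀ n', 1 ≤ n' → n' ≤ n + 1 → ((B14.Eq213MaximalDomains.side (F.P p.K).L θ.τ9.M n' : ℕ) : ℤ) < (F.P p.K).sitesPerDir 0 := by
  intro n' h1 hn'
  have hj1 : 1 ≤ min n' n := le_min h1 hn1
  have hjn : min n' n ≤ n := min_le_right _ _
  have hn'j : n' ≤ min n' n + 1 := by
    rcases Nat.le_or_le n' n with h | h
    · rw [min_eq_left h]; omega
    · rw [min_eq_right h]; omega
  obtain ⟨t, _, hR⟩ := hC1 (min n' n) hj1 hjn
  have hdvd := hpc (min n' n) hj1 hjn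
  rw [hR, hMa] at hdvd
  have hd : F.L ^ min n' n * F.L ^ a * (F.L * t) ∣ 2 * F.L ^ (F.m + p.K - 0) := hdvd
  rw [Nat.sub_zero] at hd
  have key : F.L ^ (min n' n + a + 1) ∣ 2 * F.L ^ (F.m + p.K) :=
    (Dvd.intro t (by ring) : F.L ^ (min n' n + a + 1) ∣ F.L ^ min n' n * F.L ^ a * (F.L * t)).trans hd
  have hle : min n' n + a + 1 ≤ F.m + p.K := le_of_pow_dvd_two_mul_pow F.hL.1 F.hL.2 key
  rw [hMa]
  have hLpos : 0 < F.L := by have := F.hL.2; omega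
  have hnat : B14.Eq213MaximalDomains.side (F.P p.K).L (F.L ^ a) n' < (F.P p.K).sitesPerDir 0 := by
    show F.L ^ n' * F.L ^ a < 2 * F.L ^ (F.m + p.K - 0)
    rw [Nat.sub_zero, ← pow_add]
    have h1' : F.L ^ (n' + a) ≤ F.L ^ (F.m + p.K) := Nat.pow_le_pow_right hLpos (by omega)
    have h0 : 0 < F.L ^ (F.m + p.K) := Nat.pow_pos hLpos
    omega
  exact_mod_cast hnat

end NonWrapping

/-! ## §2. ★★ The Stage-13 reduction over `(Adm, bd, Dat, Ubg)` (`Record12BgRowCoClassGaugeRGuardedBRow` §3) with `hsN` derived: row `hM`'s letter in place of the non-wrapping binder -/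

section LiftGaugeRAllTorus

variable {F : T4Family} {N : ℕ} [NeZero N]

/-- **★★ ROW P11's BODY AT A STAGE-13 BACKGROUND `Ubg p n s 𝐖` FROM THE GUARDED (8) `VariationalThm1RegSepCoP7MGB … Adm bd Dat …` AND THE GUARDED GAUGE `CoP` SENTENCE
`VariationalThm1GaugeRegSepCoP7MGB … θ.τ9.M Adm bd Dat …`, ON EVERY FAMILY** — `Record12BgRowCoClassGaugeRGuardedBRow` §3 `Stage13Params.bgAtDatumBg_of_thm1RegSepCoP7MGB_of_thm1GaugeGB`
VERBATIM (the guard `Adm` as the inner antecedent; the background `Ubg` entering only through its per-prefix `bd`-spec dichotomy `hbg` «`bd`-minimiser over the class of record, or junk `1`»;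
every data predicate `Dat`) except that its last hypothesis, the non-wrapping binder `hsN` (there demanded for every `n ≤ p.K`), is REPLACED by row `hM`'s letter `∃ a, θ.τ9.M = F.L ^ a`:
at `n ≥ 1` the binder is §1's consequence of the row's own antecedent `PartCompat₁₃ θ p n` and (C1); at `n = 0` the window of scales `1 ≤ j ≤ n` is empty.  STAGE-2 EDITION — (E1) Stage-2
coherence re-key to print's (2.3) datum (FLAG №16 ∕ LOCATE-HSEAM 5d3298b8d191f169); the (b)-keyed text (B′'s R tokens at `UbgMSCoPOfRecord`, floor `hc`) survives in git history; §3 below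
instantiates `Ubg := UbgMSCoPOfRecordB …` (node00-def-R's Stage-2 carrier at print's datum), `hbg := ubgMSCoPOfRecordB_dichotomy …`, `Adm := floorGuard F c`; k0-s1-w1's
`Record12BgRowCoClassGaugeRGuardedBRowAllTorus` ★ is the same reduction with the guard discharged by a displayed `hAdm` (it imports this file for §1, so it is not imported here).
A REDUCTION — the two sentences and the history clauses are hypotheses, never asserted.
[cite: Balaban1985Variational, (6)–(7) p.278, Thm 1 (8)–(9) p.279, (152) p.301, Prop. 8 p.304; Balaban1985RegularSpaces, (1.3)–(1.9) p.77, Prop. 6 p.99; Balaban1988Convergent, Thm 1 p.262, (2.1) p.254, (2.4)–(2.8) pp.255–256, (2.12)–(2.13) pp.256–257, p.257, (2.27)–(2.28) p.259, (2.34)–(2.41) p.261, (3.16)–(3.22) pp.268–269; Balaban1987RG1, (1.11)–(1.12) p.262; Balaban1989LargeFieldI, (0.3)–(0.4) p.176] -/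
theorem Stage13Params.bgAtDatumCoP_of_thm1RegSepCoP7M_of_thm1GaugeR_allTorus (θ : Stage13Params F N) (hθ : θ.Admissible F N) (hRz : θ.Rz = RzOfRecord F N)
    {Adm : StepGuard F} {bd : BondDatum F} {Dat : TopData F N} {B₃ B₃' a₀ a₁ : ℝ} (hM : 0 < θ.τ9.M)
    (h15 : VariationalThm1RegSepCoP7MGB F N Adm bd Dat B₃ a₀ a₁) (h15G : VariationalThm1GaugeRegSepCoP7MGB F N θ.τ9.M Adm bd Dat B₃ B₃' a₀ a₁)
    (Ubg : (p : B12.RunParams) → (n : ℕ) → SeqOfRecord F θ.ν θ.τ9.M (gOfRecord₁₃ F N θ p) p.K n → MSField (F.P p.K) (SU N) → GaugeField (F.P p.K) 0 (SU N))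
    (hbg : ∀ (p : B12.RunParams) (n : ℕ) (s : SeqOfRecord F θ.ν θ.τ9.M (gOfRecord₁₃ F N θ p) p.K n) (W : MSField (F.P p.K) (SU N)),
      B15DeterminingSetsB.IsMinimizerB (avOfRecord F N p.K) (regMSCoPOfRecord F N θ.ν p.K n s.Ω) (bd p.K n s.Ω) W (Ubg p n s W) ∨ Ubg p n s W = 1)
    (hnum : ∀ (p : B12.RunParams) (n : ℕ), n ≤ p.K → Step.InInterval θ.γ n (gOfRecord₁₃ F N θ p) → ∀ m, m ≤ n →
      0 < θ.s2.cR * epsOfRecord θ.ν (gOfRecord₁₃ F N θ p) m ∧ θ.s2.cR * epsOfRecord θ.ν (gOfRecord₁₃ F N θ p) m ≤ a₁ ∧ B₃ * (θ.s2.cR * epsOfRecord θ.ν (gOfRecord₁₃ F N θ p) m) ≤ θ.ν.εreg)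
    (ha₀ : θ.ν.εreg ≤ a₀)
    (hcomp : ∀ (p : B12.RunParams) (n : ℕ), n ≤ p.K → Step.InInterval θ.γ n (gOfRecord₁₃ F N θ p) → ∀ m, m < n →
      θ.s2.cR * epsOfRecord θ.ν (gOfRecord₁₃ F N θ p) m ≤ 2 * (θ.s2.cR * epsOfRecord θ.ν (gOfRecord₁₃ F N θ p) (m + 1)))
    (hcomp' : ∀ (p : B12.RunParams) (n : ℕ), n ≤ p.K → Step.InInterval θ.γ n (gOfRecord₁₃ F N θ p) → ∀ m, m < n →
      θ.s2.cR * epsOfRecord θ.ν (gOfRecord₁₃ F N θ p) (m + 1) ≤ 2 * (θ.s2.cR * epsOfRecord θ.ν (gOfRecord₁₃ F N θ p) m))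
    (hBα : ∀ (p : B12.RunParams) (n : ℕ), n ≤ p.K → Step.InInterval θ.γ n (gOfRecord₁₃ F N θ p) → ∀ m, 1 ≤ m → m ≤ n →
      B₃ * (θ.s2.cR * epsOfRecord θ.ν (gOfRecord₁₃ F N θ p) m) ≤ (1 - θ.s2.βc) * (lfOfRecord₁₂ F N θ.toStage12Params).alpha0 (gOfRecord₁₃ F N θ p m))
    (htI : ∀ (p : B12.RunParams) (n : ℕ), n ≤ p.K → Step.InInterval θ.γ n (gOfRecord₁₃ F N θ p) → ∀ m, 1 ≤ m → m ≤ n →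
      B₃' * (θ.s2.cR * epsOfRecord θ.ν (gOfRecord₁₃ F N θ p) m) ≤ θ.s2.cB * (lfOfRecord₁₂ F N θ.toStage12Params).alpha0 (gOfRecord₁₃ F N θ p m))
    (htMS : ∀ (p : B12.RunParams) (n : ℕ), n ≤ p.K → Step.InInterval θ.γ n (gOfRecord₁₃ F N θ p) → ∀ m, 1 ≤ m → m ≤ n →
      B₃' * (θ.s2.cR * epsOfRecord θ.ν (gOfRecord₁₃ F N θ p) m) ≤ θ.s2.B * θ.s2.C * θ.s2.Mr * (lfOfRecord₁₂ F N θ.toStage12Params).alpha0 (gOfRecord₁₃ F N θ p m))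
    (hC1 : ∀ (p : B12.RunParams) (n : ℕ), n ≤ p.K → Step.InInterval θ.γ n (gOfRecord₁₃ F N θ p) → ∀ j, 1 ≤ j → j ≤ n →
      ∃ t : ℕ, 0 < t ∧ RkOfRecord (F.P p.K).L θ.ν.r (gOfRecord₁₃ F N θ p j) = (F.P p.K).L * t)
    (hMa : ∃ a : ℕ, θ.τ9.M = F.L ^ a) :
    ∀ (p : B12.RunParams) (n : ℕ), n ≤ p.K → Step.InInterval θ.γ n (gOfRecord₁₃ F N θ p) → PartCompat₁₃ F N θ p n →
      ∀ s : SeqOfRecord F θ.ν θ.τ9.M (gOfRecord₁₃ F N θ p) p.K n, Sect2.SeqSeparated θ.ν.M₁ s → 0 < θ.ν.M₁ →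
      Adm θ.ν θ.τ9.M (gOfRecord₁₃ F N θ p) p.K n s → ∀ W : MSField (F.P p.K) (SU N),
      Dat p.K s.Ω (suppDomOfRecord F θ.ν p.K s.Ω) n (fun j => θ.s2.cR * epsOfRecord θ.ν (gOfRecord₁₃ F N θ p) j) W →
      ∀ j, 1 ≤ j → j ≤ n → ∀ X : (Sect2.domSys (F.P p.K) θ.τ9.M j).Dom,
      (Sect2.domSites (F.P p.K) θ.τ9.M j X ⊆ s.Λ j →
        Sect2.ofBackgroundC (settingOfRecord₁₃ F N θ p).ι (Ubg p n s W) ∈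
          Sect2.spaceI (settingOfRecord₁₃ F N θ p) (θ.Rz p.K) θ.τ9.M j (Sect2.domSites (F.P p.K) θ.τ9.M j X)
            ((settingOfRecord₁₃ F N θ p).lf.alpha0 ((settingOfRecord₁₃ F N θ p).flow.g j)) ((settingOfRecord₁₃ F N θ p).lf.alpha1 ((settingOfRecord₁₃ F N θ p).flow.g j))) ∧
      (Sect2.admB (F.P p.K) θ.ν θ.τ9.M (gOfRecord₁₃ F N θ p) s.Ω s.Λ j (Sect2.domSites (F.P p.K) θ.τ9.M j X) = true →
        Sect2.ofBackgroundC (settingOfRecord₁₃ F N θ p).ι (Ubg p n s W) ∈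
          Sect2.spaceMS (settingOfRecord₁₃ F N θ p) (θ.Rz p.K) θ.τ9.M j (Sect2.domSites (F.P p.K) θ.τ9.M j X) s.Ω) := by
  intro p n hn hw hpc s hsep hM₁ hadm W h7
  obtain ⟨a, ha⟩ := hMa
  rcases Nat.eq_zero_or_pos n with rfl | hn1
  · intro j h1 hj; exfalso; omega
  · rw [hRz]
    exact bgRowAtDatumBg_of_thm1RegSepCoP7MGB_of_thm1GaugeGB h15 h15G (settingOfRecord₁₃ F N θ p) rfl rfl (settingOfRecord₁₃_laws F N θ p)
      (settingOfRecord₁₃_pos F N θ hθ.1.pos p) θ.ν hM p.K n θ.s2.cR (hnum p n hn hw) ha₀ (hcomp p n hn hw) (hcomp' p n hn hw)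
      (fun m _ hm => alphaPos₁₃_of_inInterval hθ hw hm) (hBα p n hn hw) (htI p n hn hw) (htMS p n hn hw) (hC1 p n hn hw) hpc
      (Stage13Params.hsN_of_partCompat₁₃ θ ha hn1 hpc (hC1 p n hn hw)) s hsep hM₁ hadm W h7 _ (hbg p n s W)

end LiftGaugeRAllTorus

/-! ## §3. ★★★ At `θ₁₅ᶜᶜᴹ(j; γ)`: the (7)-guarded separated row P11 at the Co carrier from (8), the R gauge sentence and (hcomp) ∧ (hcompRev) — on EVERY family -/

section AtWitnessGaugeRWHAllTorus

variable {F : T4Family} {N : ℕ} [NeZero N] {j c : ℕ} {γ ε₀ ε₂₉ B₃ B₃' a₀ a₁ : ℝ}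

/-- **★★★ THE (7)-GUARDED SEPARATED ROW P11 AT THE Co CARRIER AT `θ₁₅ᶜᶜᴹ(j; γ)` FROM `0 < γ ≤ ½`, (8), THE R GAUGE SENTENCE AND (hcomp) ∧ (hcompRev), ON EVERY FAMILY** — Eʷ's ★★★ʷʰ
`bgSepCoPAt_theta13OfThm1CCMW_of_thm1GaugeR_of_hcomp` with the binder `hjm : j + 1 ≤ F.m` DROPPED (statement otherwise verbatim): §2 at the witness with `τ9.M = L^j` (`rfl`), `Ubg := UbgMSCoPOfRecordB …` (the level-`n+1` carrier `UbgOfRecord₁₃CoP_succ`, Stage 2), `hbg := ubgMSCoPOfRecordB_dichotomy …`,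
guard `floorGuard F c` discharged by `hc` (`M₁ = L^j`).
CONDITIONAL; nothing of Bałaban asserted. [cite: Balaban1985Variational, (6)–(7) p.278, Thm 1 (8)–(9) p.279, (144)–(152) pp.300–301, Prop. 8 p.304; Balaban1985RegularSpaces, (1.3)–(1.9) p.77; Balaban1988Convergent, Thm 1 p.262, (2.1) p.254, (2.4)–(2.8) pp.255–256, (2.12)–(2.13) pp.256–257, (2.18) p.257, (2.25)–(2.28) pp.258–259; Balaban1987RG1, Thm 1 p.259, (1.12) p.262] -/
theorem bgSepCoPAt_theta13OfThm1CCMW_of_thm1GaugeR_of_hcomp_allTorus (hγ0 : 0 < γ) (hγ : γ ≤ 1 / 2) (hε : 0 < ε₀) (hε' : 0 < ε₂₉) (hB : 0 ≤ B₃) (hB' : 0 ≤ B₃') (ha₀ : 0 < a₀) (ha₁ : 0 < a₁)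
    (h15 : VariationalThm1RegSepCoP7MGB F N (floorGuard F c) (lamDatum F) (dataSmall7PTopOf F N) B₃ a₀ a₁) (hc : c ≤ F.L ^ j) (h15G : VariationalThm1GaugeRegSepCoP7MGB F N (F.L ^ j) (floorGuard F c) (lamDatum F) (dataSmall7PTopOf F N) B₃ B₃' a₀ a₁)
    (hcomp : ∀ (p : B12.RunParams) (n : ℕ), n ≤ p.K → Step.InInterval (theta13OfThm1CCMW F N j γ ε₀ ε₂₉ B₃ B₃' a₀ a₁).γ n (gOfRecord₁₃ F N (theta13OfThm1CCMW F N j γ ε₀ ε₂₉ B₃ B₃' a₀ a₁) p) → ∀ m, m < n →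
      (theta13OfThm1CCMW F N j γ ε₀ ε₂₉ B₃ B₃' a₀ a₁).s2.cR * epsOfRecord (theta13OfThm1CCMW F N j γ ε₀ ε₂₉ B₃ B₃' a₀ a₁).ν (gOfRecord₁₃ F N (theta13OfThm1CCMW F N j γ ε₀ ε₂₉ B₃ B₃' a₀ a₁) p) m ≤ 2 * ((theta13OfThm1CCMW F N j γ ε₀ ε₂₉ B₃ B₃' a₀ a₁).s2.cR * epsOfRecord (theta13OfThm1CCMW F N j γ ε₀ ε₂₉ B₃ B₃' a₀ a₁).ν (gOfRecord₁₃ F N (theta13OfThm1CCMW F N j γ ε₀ ε₂₉ B₃ B₃' a₀ a₁) p) (m + 1)))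
    (hcompRev : ∀ (p : B12.RunParams) (n : ℕ), n ≤ p.K → Step.InInterval (theta13OfThm1CCMW F N j γ ε₀ ε₂₉ B₃ B₃' a₀ a₁).γ n (gOfRecord₁₃ F N (theta13OfThm1CCMW F N j γ ε₀ ε₂₉ B₃ B₃' a₀ a₁) p) → ∀ m, m < n →
      (theta13OfThm1CCMW F N j γ ε₀ ε₂₉ B₃ B₃' a₀ a₁).s2.cR * epsOfRecord (theta13OfThm1CCMW F N j γ ε₀ ε₂₉ B₃ B₃' a₀ a₁).ν (gOfRecord₁₃ F N (theta13OfThm1CCMW F N j γ ε₀ ε₂₉ B₃ B₃' a₀ a₁) p) (m + 1) ≤ 2 * ((theta13OfThm1CCMW F N j γ ε₀ ε₂₉ B₃ B₃' a₀ a₁).s2.cR * epsOfRecord (theta13OfThm1CCMW F N j γ ε₀ ε₂₉ B₃ B₃' a₀ a₁).ν (gOfRecord₁₃ F N (theta13OfThm1CCMW F N j γ ε₀ ε₂₉ B₃ B₃' a₀ a₁) p) m)) :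
    ∀ (p : B12.RunParams) (n : ℕ), n ≤ p.K → Step.InInterval (theta13OfThm1CCMW F N j γ ε₀ ε₂₉ B₃ B₃' a₀ a₁).γ n (gOfRecord₁₃ F N (theta13OfThm1CCMW F N j γ ε₀ ε₂₉ B₃ B₃' a₀ a₁) p) → PartCompat₁₃ F N (theta13OfThm1CCMW F N j γ ε₀ ε₂₉ B₃ B₃' a₀ a₁) p n →
      ∀ s : SeqOfRecord F (theta13OfThm1CCMW F N j γ ε₀ ε₂₉ B₃ B₃' a₀ a₁).ν (theta13OfThm1CCMW F N j γ ε₀ ε₂₉ B₃ B₃' a₀ a₁).τ9.M (gOfRecord₁₃ F N (theta13OfThm1CCMW F N j γ ε₀ ε₂₉ B₃ B₃' a₀ a₁) p) p.K n, Sect2.SeqSeparated (theta13OfThm1CCMW F N j γ ε₀ ε₂₉ B₃ B₃' a₀ a₁).ν.M₁ s →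
      ∀ W : MSField (F.P p.K) (SU N), W ∈ suppOfRecord₁₃P F N (theta13OfThm1CCMW F N j γ ε₀ ε₂₉ B₃ B₃' a₀ a₁) p n s →
      Sect2.DataSmall7PTop (avOfRecord F N p.K) s.Ω (suppDomOfRecord F (theta13OfThm1CCMW F N j γ ε₀ ε₂₉ B₃ B₃' a₀ a₁).ν p.K s.Ω) n (fun j' => (theta13OfThm1CCMW F N j γ ε₀ ε₂₉ B₃ B₃' a₀ a₁).s2.cR * epsOfRecord (theta13OfThm1CCMW F N j γ ε₀ ε₂₉ B₃ B₃' a₀ a₁).ν (gOfRecord₁₃ F N (theta13OfThm1CCMW F N j γ ε₀ ε₂₉ B₃ B₃' a₀ a₁) p) j') W →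
      ∀ j', 1 ≤ j' → j' ≤ n → ∀ X : (Sect2.domSys (F.P p.K) (theta13OfThm1CCMW F N j γ ε₀ ε₂₉ B₃ B₃' a₀ a₁).τ9.M j').Dom,
      (Sect2.domSites (F.P p.K) (theta13OfThm1CCMW F N j γ ε₀ ε₂₉ B₃ B₃' a₀ a₁).τ9.M j' X ⊆ s.Λ j' →
        Sect2.ofBackgroundC (settingOfRecord₁₃ F N (theta13OfThm1CCMW F N j γ ε₀ ε₂₉ B₃ B₃' a₀ a₁) p).ι (UbgOfRecord₁₃CoP F N (theta13OfThm1CCMW F N j γ ε₀ ε₂₉ B₃ B₃' a₀ a₁) p n s W) ∈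
          Sect2.spaceI (settingOfRecord₁₃ F N (theta13OfThm1CCMW F N j γ ε₀ ε₂₉ B₃ B₃' a₀ a₁) p) ((theta13OfThm1CCMW F N j γ ε₀ ε₂₉ B₃ B₃' a₀ a₁).Rz p.K) (theta13OfThm1CCMW F N j γ ε₀ ε₂₉ B₃ B₃' a₀ a₁).τ9.M j' (Sect2.domSites (F.P p.K) (theta13OfThm1CCMW F N j γ ε₀ ε₂₉ B₃ B₃' a₀ a₁).τ9.M j' X)
            ((settingOfRecord₁₃ F N (theta13OfThm1CCMW F N j γ ε₀ ε₂₉ B₃ B₃' a₀ a₁) p).lf.alpha0 ((settingOfRecord₁₃ F N (theta13OfThm1CCMW F N j γ ε₀ ε₂₉ B₃ B₃' a₀ a₁) p).flow.g j')) ((settingOfRecord₁₃ F N (theta13OfThm1CCMW F N j γ ε₀ ε₂₉ B₃ B₃' a₀ a₁) p).lf.alpha1 ((settingOfRecord₁₃ F N (theta13OfThm1CCMW F N j γ ε₀ ε₂₉ B₃ B₃' a₀ a₁) p).flow.g j'))) ∧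
      (Sect2.admB (F.P p.K) (theta13OfThm1CCMW F N j γ ε₀ ε₂₉ B₃ B₃' a₀ a₁).ν (theta13OfThm1CCMW F N j γ ε₀ ε₂₉ B₃ B₃' a₀ a₁).τ9.M (gOfRecord₁₃ F N (theta13OfThm1CCMW F N j γ ε₀ ε₂₉ B₃ B₃' a₀ a₁) p) s.Ω s.Λ j' (Sect2.domSites (F.P p.K) (theta13OfThm1CCMW F N j γ ε₀ ε₂₉ B₃ B₃' a₀ a₁).τ9.M j' X) = true →
        Sect2.ofBackgroundC (settingOfRecord₁₃ F N (theta13OfThm1CCMW F N j γ ε₀ ε₂₉ B₃ B₃' a₀ a₁) p).ι (UbgOfRecord₁₃CoP F N (theta13OfThm1CCMW F N j γ ε₀ ε₂₉ B₃ B₃' a₀ a₁) p n s W) ∈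
          Sect2.spaceMS (settingOfRecord₁₃ F N (theta13OfThm1CCMW F N j γ ε₀ ε₂₉ B₃ B₃' a₀ a₁) p) ((theta13OfThm1CCMW F N j γ ε₀ ε₂₉ B₃ B₃' a₀ a₁).Rz p.K) (theta13OfThm1CCMW F N j γ ε₀ ε₂₉ B₃ B₃' a₀ a₁).τ9.M j' (Sect2.domSites (F.P p.K) (theta13OfThm1CCMW F N j γ ε₀ ε₂₉ B₃ B₃' a₀ a₁).τ9.M j' X) s.Ω) := by
  intro p n hn hw hpc s hsep W _ h7
  cases n with
  | zero => intro j' h1 hj'; exfalso; omega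
  | succ n =>
    rw [UbgOfRecord₁₃CoP_succ]
    exact Stage13Params.bgAtDatumCoP_of_thm1RegSepCoP7M_of_thm1GaugeR_allTorus (theta13OfThm1CCMW F N j γ ε₀ ε₂₉ B₃ B₃' a₀ a₁) (admissible_theta13OfThm1CCMW_of_le_half F N hγ0 hγ hε hε' hB hB' ha₀ ha₁) rfl
      (τ9_M_pos_theta13OfThm1CCMW F N j γ ε₀ ε₂₉ B₃ B₃' a₀ a₁) h15 h15G
      (fun p n s W => UbgMSCoPOfRecordB F N (theta13OfThm1CCMW F N j γ ε₀ ε₂₉ B₃ B₃' a₀ a₁).ν (theta13OfThm1CCMW F N j γ ε₀ ε₂₉ B₃ B₃' a₀ a₁).τ9.M (gOfRecord₁₃ F N (theta13OfThm1CCMW F N j γ ε₀ ε₂₉ B₃ B₃' a₀ a₁) p) p.K n s W)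
      (fun p n s W => ubgMSCoPOfRecordB_dichotomy (theta13OfThm1CCMW F N j γ ε₀ ε₂₉ B₃ B₃' a₀ a₁).ν (theta13OfThm1CCMW F N j γ ε₀ ε₂₉ B₃ B₃' a₀ a₁).τ9.M (gOfRecord₁₃ F N (theta13OfThm1CCMW F N j γ ε₀ ε₂₉ B₃ B₃' a₀ a₁) p) p.K n s W)
      (hnum_theta13OfThm1CCMW hγ hB hB' ha₀ ha₁) εreg_le_theta13OfThm1CCMW
      hcomp hcompRev (hBα_theta13OfThm1CCMW hγ hB hB' ha₀.le ha₁.le)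
      (htI_theta13OfThm1CCMW hγ hB hB' ha₀.le ha₁.le) (htMS_theta13OfThm1CCMW hγ hB hB' ha₀.le ha₁.le) (hC1_theta13OfThm1CCMW hγ) ⟨j, theta13OfThm1CCMW_τ9_M F N j γ ε₀ ε₂₉ B₃ B₃' a₀ a₁⟩
      p (n + 1) hn hw hpc s hsep (M₁_pos_theta13OfThm1CCMW F N j γ ε₀ ε₂₉ B₃ B₃' a₀ a₁) (show c ≤ (theta13OfThm1CCMW F N j γ ε₀ ε₂₉ B₃ B₃' a₀ a₁).ν.M₁ by rw [theta13OfThm1CCMW_M₁]; exact hc) W h7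

end AtWitnessGaugeRWHAllTorus

/-! ## §4. Closers keyed on (hcomp) ∧ (hcompRev) on EVERY family, and the cube instance without `4 ≤ F.m` -/

section ClosersGaugeRWHAllTorus

variable {j c : ℕ} {γ ε₀ ε₂₉ B₃ B₃' a₀ a₁ : ℝ}

/-- **THE v1.5 K0 BODY (⁵) FOR `F` AT `N = 2` AT `θ₁₅ᶜᶜᴹ(j; γ)` FROM `0 < γ ≤ ½`, (8), THE R GAUGE SENTENCE AND (hcomp) ∧ (hcompRev), ON EVERY FAMILY** (16a's socket ∘ §3) — Eʷ's
`exists_k0SepCoP_thm1CCMW_of_thm1GaugeR_of_hcomp` without `hjm`.  CONDITIONAL; K0 NOT closed here. [cite: Balaban1985Variational, Thm 1 (8)–(9) p.279, (152) p.301, Prop. 8 p.304; Balaban1988Convergent, Thm 1 p.262, (2.4)–(2.8) pp.255–256, p.257; Balaban1987RG1, Thm 1 p.259] -/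
theorem exists_k0SepCoP_thm1CCMW_of_thm1GaugeR_of_hcomp_allTorus (F : T4Family) (hγ0 : 0 < γ) (hγ : γ ≤ 1 / 2) (hε : 0 < ε₀) (hε' : 0 < ε₂₉) (hB : 0 ≤ B₃) (hB' : 0 ≤ B₃')
    (ha₀ : 0 < a₀) (ha₁ : 0 < a₁) (h15 : VariationalThm1RegSepCoP7MGB F 2 (floorGuard F c) (lamDatum F) (dataSmall7PTopOf F 2) B₃ a₀ a₁) (hc : c ≤ F.L ^ j) (h15G : VariationalThm1GaugeRegSepCoP7MGB F 2 (F.L ^ j) (floorGuard F c) (lamDatum F) (dataSmall7PTopOf F 2) B₃ B₃' a₀ a₁)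
    (hcomp : ∀ (p : B12.RunParams) (n : ℕ), n ≤ p.K → Step.InInterval (theta13OfThm1CCMW F 2 j γ ε₀ ε₂₉ B₃ B₃' a₀ a₁).γ n (gOfRecord₁₃ F 2 (theta13OfThm1CCMW F 2 j γ ε₀ ε₂₉ B₃ B₃' a₀ a₁) p) → ∀ m, m < n →
      (theta13OfThm1CCMW F 2 j γ ε₀ ε₂₉ B₃ B₃' a₀ a₁).s2.cR * epsOfRecord (theta13OfThm1CCMW F 2 j γ ε₀ ε₂₉ B₃ B₃' a₀ a₁).ν (gOfRecord₁₃ F 2 (theta13OfThm1CCMW F 2 j γ ε₀ ε₂₉ B₃ B₃' a₀ a₁) p) m ≤ 2 * ((theta13OfThm1CCMW F 2 j γ ε₀ ε₂₉ B₃ B₃' a₀ a₁).s2.cR * epsOfRecord (theta13OfThm1CCMW F 2 j γ ε₀ ε₂₉ B₃ B₃' a₀ a₁).ν (gOfRecord₁₃ F 2 (theta13OfThm1CCMW F 2 j γ ε₀ ε₂₉ B₃ B₃' a₀ a₁) p) (m + 1)))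
    (hcompRev : ∀ (p : B12.RunParams) (n : ℕ), n ≤ p.K → Step.InInterval (theta13OfThm1CCMW F 2 j γ ε₀ ε₂₉ B₃ B₃' a₀ a₁).γ n (gOfRecord₁₃ F 2 (theta13OfThm1CCMW F 2 j γ ε₀ ε₂₉ B₃ B₃' a₀ a₁) p) → ∀ m, m < n →
      (theta13OfThm1CCMW F 2 j γ ε₀ ε₂₉ B₃ B₃' a₀ a₁).s2.cR * epsOfRecord (theta13OfThm1CCMW F 2 j γ ε₀ ε₂₉ B₃ B₃' a₀ a₁).ν (gOfRecord₁₃ F 2 (theta13OfThm1CCMW F 2 j γ ε₀ ε₂₉ B₃ B₃' a₀ a₁) p) (m + 1) ≤ 2 * ((theta13OfThm1CCMW F 2 j γ ε₀ ε₂₉ B₃ B₃' a₀ a₁).s2.cR * epsOfRecord (theta13OfThm1CCMW F 2 j γ ε₀ ε₂₉ B₃ B₃' a₀ a₁).ν (gOfRecord₁₃ F 2 (theta13OfThm1CCMW F 2 j γ ε₀ ε₂₉ B₃ B₃' a₀ a₁) p) m)) :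
    ∃ θ : Stage13Params F 2, θ.Provisos₁₃SepCoP F 2 ∧ (θ.ZtUnity F 2 ∧ θ.SlotsNondegenerate₁₃ F 2) ∧ θ.Admissible F 2 :=
  exists_k0SepCoP_of_bgSepCoP_theta13LiveOfNumerics F (stage12NumericsOfThm1CCMW_pos_of_le_half (L := F.L) (j := j) F.hL.2.le hγ0 hγ hε hB hB' ha₀ ha₁) hε' ⟨j, rfl⟩ (dvd_refl _)
    (bgSepCoPAt_theta13OfThm1CCMW_of_thm1GaugeR_of_hcomp_allTorus hγ0 hγ hε hε' hB hB' ha₀ ha₁ h15 hc h15G hcomp hcompRev)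

/-- **THE ⁷ IMAGE, ON EVERY FAMILY** (FILE 18's cured lift, T's history-blind door) — Eʷ's `exists_k0SepCoPH_thm1CCMW_of_thm1GaugeR_of_hcomp` without `hjm`.
[cite: Balaban1988Convergent, Thm 1 p.262, (2.21) p.258, (3.16)–(3.23) pp.268–270; Balaban1989LargeFieldI, (0.2)–(0.4) p.176] -/
theorem exists_k0SepCoPH_thm1CCMW_of_thm1GaugeR_of_hcomp_allTorus (F : T4Family) (hγ0 : 0 < γ) (hγ : γ ≤ 1 / 2) (hε : 0 < ε₀) (hε' : 0 < ε₂₉) (hB : 0 ≤ B₃) (hB' : 0 ≤ B₃')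
    (ha₀ : 0 < a₀) (ha₁ : 0 < a₁) (h15 : VariationalThm1RegSepCoP7MGB F 2 (floorGuard F c) (lamDatum F) (dataSmall7PTopOf F 2) B₃ a₀ a₁) (hc : c ≤ F.L ^ j) (h15G : VariationalThm1GaugeRegSepCoP7MGB F 2 (F.L ^ j) (floorGuard F c) (lamDatum F) (dataSmall7PTopOf F 2) B₃ B₃' a₀ a₁)
    (hcomp : ∀ (p : B12.RunParams) (n : ℕ), n ≤ p.K → Step.InInterval (theta13OfThm1CCMW F 2 j γ ε₀ ε₂₉ B₃ B₃' a₀ a₁).γ n (gOfRecord₁₃ F 2 (theta13OfThm1CCMW F 2 j γ ε₀ ε₂₉ B₃ B₃' a₀ a₁) p) → ∀ m, m < n →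
      (theta13OfThm1CCMW F 2 j γ ε₀ ε₂₉ B₃ B₃' a₀ a₁).s2.cR * epsOfRecord (theta13OfThm1CCMW F 2 j γ ε₀ ε₂₉ B₃ B₃' a₀ a₁).ν (gOfRecord₁₃ F 2 (theta13OfThm1CCMW F 2 j γ ε₀ ε₂₉ B₃ B₃' a₀ a₁) p) m ≤ 2 * ((theta13OfThm1CCMW F 2 j γ ε₀ ε₂₉ B₃ B₃' a₀ a₁).s2.cR * epsOfRecord (theta13OfThm1CCMW F 2 j γ ε₀ ε₂₉ B₃ B₃' a₀ a₁).ν (gOfRecord₁₃ F 2 (theta13OfThm1CCMW F 2 j γ ε₀ ε₂₉ B₃ B₃' a₀ a₁) p) (m + 1)))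
    (hcompRev : ∀ (p : B12.RunParams) (n : ℕ), n ≤ p.K → Step.InInterval (theta13OfThm1CCMW F 2 j γ ε₀ ε₂₉ B₃ B₃' a₀ a₁).γ n (gOfRecord₁₃ F 2 (theta13OfThm1CCMW F 2 j γ ε₀ ε₂₉ B₃ B₃' a₀ a₁) p) → ∀ m, m < n →
      (theta13OfThm1CCMW F 2 j γ ε₀ ε₂₉ B₃ B₃' a₀ a₁).s2.cR * epsOfRecord (theta13OfThm1CCMW F 2 j γ ε₀ ε₂₉ B₃ B₃' a₀ a₁).ν (gOfRecord₁₃ F 2 (theta13OfThm1CCMW F 2 j γ ε₀ ε₂₉ B₃ B₃' a₀ a₁) p) (m + 1) ≤ 2 * ((theta13OfThm1CCMW F 2 j γ ε₀ ε₂₉ B₃ B₃' a₀ a₁).s2.cR * epsOfRecord (theta13OfThm1CCMW F 2 j γ ε₀ ε₂₉ B₃ B₃' a₀ a₁).ν (gOfRecord₁₃ F 2 (theta13OfThm1CCMW F 2 j γ ε₀ ε₂₉ B₃ B₃' a₀ a₁) p) m)) :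
    ∃ θ : Stage13HParams F 2, θ.Provisos₁₃SepCoPH F 2 ∧ (θ.ZhUnity F 2 ∧ θ.SlotsNondegenerate₁₃ F 2) ∧ θ.Admissible F 2 :=
  exists_k0SepCoPH_of_exists_k0SepCoPR (exists_k0SepCoPR_of_exists_k0SepCoP F
    (exists_k0SepCoP_thm1CCMW_of_thm1GaugeR_of_hcomp_allTorus F hγ0 hγ hε hε' hB hB' ha₀ ha₁ h15 hc h15G hcomp hcompRev))

/-- **THE ⁷ K0 BODY AT THE WINDOW EDITION KEYED ON dag-n07-e's FLOOR-CARRYING STEP FACT AND (hcomp) ∧ (hcompRev), ON EVERY FAMILY** (`Record12BgRowCoClassGaugeRGuardedB` §3: minimal ⇒ critical on the `lamDatum`-fibre) —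
Eʷ's `exists_k0SepCoPH_thm1CCMW_of_gauge9TopStepR_of_hcomp` without `hjm`.  CONDITIONAL. [cite: Balaban1985Variational, (144)–(152) pp.300–301, Prop. 8 p.304; Balaban1988Convergent, Thm 1 p.262, (2.21) p.258, p.257; Balaban1989LargeFieldI, (0.2)–(0.4) p.176] -/
theorem exists_k0SepCoPH_thm1CCMW_of_gauge9TopStepR_of_hcomp_allTorus (F : T4Family) (hγ0 : 0 < γ) (hγ : γ ≤ 1 / 2) (hε : 0 < ε₀) (hε' : 0 < ε₂₉) (hB : 0 ≤ B₃) (hB' : 0 ≤ B₃')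
    (ha₀ : 0 < a₀) (ha₁ : 0 < a₁) (h15 : VariationalThm1RegSepCoP7MGB F 2 (floorGuard F c) (lamDatum F) (dataSmall7PTopOf F 2) B₃ a₀ a₁) (hc : c ≤ F.L ^ j)
    (h9 : Gauge9RegSepTopStepGB F 2 (fun ν K Ω => suppDomOfRecord F ν K Ω) (F.L ^ j) (floorGuard F c) (lamDatum F) (dataSmall7PTopOf F 2) B₃ B₃' a₀ a₁)
    (hcomp : ∀ (p : B12.RunParams) (n : ℕ), n ≤ p.K → Step.InInterval (theta13OfThm1CCMW F 2 j γ ε₀ ε₂₉ B₃ B₃' a₀ a₁).γ n (gOfRecord₁₃ F 2 (theta13OfThm1CCMW F 2 j γ ε₀ ε₂₉ B₃ B₃' a₀ a₁) p) → ∀ m, m < n →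
      (theta13OfThm1CCMW F 2 j γ ε₀ ε₂₉ B₃ B₃' a₀ a₁).s2.cR * epsOfRecord (theta13OfThm1CCMW F 2 j γ ε₀ ε₂₉ B₃ B₃' a₀ a₁).ν (gOfRecord₁₃ F 2 (theta13OfThm1CCMW F 2 j γ ε₀ ε₂₉ B₃ B₃' a₀ a₁) p) m ≤ 2 * ((theta13OfThm1CCMW F 2 j γ ε₀ ε₂₉ B₃ B₃' a₀ a₁).s2.cR * epsOfRecord (theta13OfThm1CCMW F 2 j γ ε₀ ε₂₉ B₃ B₃' a₀ a₁).ν (gOfRecord₁₃ F 2 (theta13OfThm1CCMW F 2 j γ ε₀ ε₂₉ B₃ B₃' a₀ a₁) p) (m + 1)))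
    (hcompRev : ∀ (p : B12.RunParams) (n : ℕ), n ≤ p.K → Step.InInterval (theta13OfThm1CCMW F 2 j γ ε₀ ε₂₉ B₃ B₃' a₀ a₁).γ n (gOfRecord₁₃ F 2 (theta13OfThm1CCMW F 2 j γ ε₀ ε₂₉ B₃ B₃' a₀ a₁) p) → ∀ m, m < n →
      (theta13OfThm1CCMW F 2 j γ ε₀ ε₂₉ B₃ B₃' a₀ a₁).s2.cR * epsOfRecord (theta13OfThm1CCMW F 2 j γ ε₀ ε₂₉ B₃ B₃' a₀ a₁).ν (gOfRecord₁₃ F 2 (theta13OfThm1CCMW F 2 j γ ε₀ ε₂₉ B₃ B₃' a₀ a₁) p) (m + 1) ≤ 2 * ((theta13OfThm1CCMW F 2 j γ ε₀ ε₂₉ B₃ B₃' a₀ a₁).s2.cR * epsOfRecord (theta13OfThm1CCMW F 2 j γ ε₀ ε₂₉ B₃ B₃' a₀ a₁).ν (gOfRecord₁₃ F 2 (theta13OfThm1CCMW F 2 j γ ε₀ ε₂₉ B₃ B₃' a₀ a₁) p) m)) :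
    ∃ θ : Stage13HParams F 2, θ.Provisos₁₃SepCoPH F 2 ∧ (θ.ZhUnity F 2 ∧ θ.SlotsNondegenerate₁₃ F 2) ∧ θ.Admissible F 2 :=
  exists_k0SepCoPH_thm1CCMW_of_thm1GaugeR_of_hcomp_allTorus F hγ0 hγ hε hε' hB hB' ha₀ ha₁ h15 hc (variationalThm1GaugeRegSepCoP7MGB_of_gauge9TopStepGB h9) hcomp hcompRev

/-- **★ THE `_cube` INSTANCE ON EVERY FAMILY** (`j = 3`, `M = M₁ = L³`, floor `c = (11·4 + 3L)·L`, A2ʷ `collar_le_M₁_theta13OfThm1CCMW`; NO `4 ≤ F.m`: at a family with `F.m ≤ 3` the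
guarded runs simply never reach a length at which a level-`n` 𝐃-cube of side `L^{n+3}·R_n` would have to divide the period — row `bg` is then demanded only where the cubes fit).
CONDITIONAL. [cite: Balaban1985Variational, (144)–(152) pp.300–301, Prop. 8 p.304; Balaban1985RegularSpaces, (1.130) p.99; Balaban1988Convergent, Thm 1 p.262, p.257] -/
theorem exists_k0SepCoPH_thm1CCMW_of_gauge9TopStepR_of_hcomp_cube_allTorus (F : T4Family) (hγ0 : 0 < γ) (hγ : γ ≤ 1 / 2) (hε : 0 < ε₀) (hε' : 0 < ε₂₉) (hB : 0 ≤ B₃) (hB' : 0 ≤ B₃')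
    (ha₀ : 0 < a₀) (ha₁ : 0 < a₁) (h15 : VariationalThm1RegSepCoP7MGB F 2 (floorGuard F ((11 * 4 + 3 * F.L) * F.L)) (lamDatum F) (dataSmall7PTopOf F 2) B₃ a₀ a₁)
    (h9 : Gauge9RegSepTopStepGB F 2 (fun ν K Ω => suppDomOfRecord F ν K Ω) (F.L ^ 3) (floorGuard F ((11 * 4 + 3 * F.L) * F.L)) (lamDatum F) (dataSmall7PTopOf F 2) B₃ B₃' a₀ a₁)
    (hcomp : ∀ (p : B12.RunParams) (n : ℕ), n ≤ p.K → Step.InInterval (theta13OfThm1CCMW F 2 3 γ ε₀ ε₂₉ B₃ B₃' a₀ a₁).γ n (gOfRecord₁₃ F 2 (theta13OfThm1CCMW F 2 3 γ ε₀ ε₂₉ B₃ B₃' a₀ a₁) p) → ∀ m, m < n →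
      (theta13OfThm1CCMW F 2 3 γ ε₀ ε₂₉ B₃ B₃' a₀ a₁).s2.cR * epsOfRecord (theta13OfThm1CCMW F 2 3 γ ε₀ ε₂₉ B₃ B₃' a₀ a₁).ν (gOfRecord₁₃ F 2 (theta13OfThm1CCMW F 2 3 γ ε₀ ε₂₉ B₃ B₃' a₀ a₁) p) m ≤ 2 * ((theta13OfThm1CCMW F 2 3 γ ε₀ ε₂₉ B₃ B₃' a₀ a₁).s2.cR * epsOfRecord (theta13OfThm1CCMW F 2 3 γ ε₀ ε₂₉ B₃ B₃' a₀ a₁).ν (gOfRecord₁₃ F 2 (theta13OfThm1CCMW F 2 3 γ ε₀ ε₂₉ B₃ B₃' a₀ a₁) p) (m + 1)))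
    (hcompRev : ∀ (p : B12.RunParams) (n : ℕ), n ≤ p.K → Step.InInterval (theta13OfThm1CCMW F 2 3 γ ε₀ ε₂₉ B₃ B₃' a₀ a₁).γ n (gOfRecord₁₃ F 2 (theta13OfThm1CCMW F 2 3 γ ε₀ ε₂₉ B₃ B₃' a₀ a₁) p) → ∀ m, m < n →
      (theta13OfThm1CCMW F 2 3 γ ε₀ ε₂₉ B₃ B₃' a₀ a₁).s2.cR * epsOfRecord (theta13OfThm1CCMW F 2 3 γ ε₀ ε₂₉ B₃ B₃' a₀ a₁).ν (gOfRecord₁₃ F 2 (theta13OfThm1CCMW F 2 3 γ ε₀ ε₂₉ B₃ B₃' a₀ a₁) p) (m + 1) ≤ 2 * ((theta13OfThm1CCMW F 2 3 γ ε₀ ε₂₉ B₃ B₃' a₀ a₁).s2.cR * epsOfRecord (theta13OfThm1CCMW F 2 3 γ ε₀ ε₂₉ B₃ B₃' a₀ a₁).ν (gOfRecord₁₃ F 2 (theta13OfThm1CCMW F 2 3 γ ε₀ ε₂₉ B₃ B₃' a₀ a₁) p) m)) :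
    ∃ θ : Stage13HParams F 2, θ.Provisos₁₃SepCoPH F 2 ∧ (θ.ZhUnity F 2 ∧ θ.SlotsNondegenerate₁₃ F 2) ∧ θ.Admissible F 2 :=
  exists_k0SepCoPH_thm1CCMW_of_gauge9TopStepR_of_hcomp_allTorus F (j := 3) hγ0 hγ hε hε' hB hB' ha₀ ha₁ h15
    ((theta13OfThm1CCMW_M₁ F 2 3 γ ε₀ ε₂₉ B₃ B₃' a₀ a₁) ▸ collar_le_M₁_theta13OfThm1CCMW F 2 γ ε₀ ε₂₉ B₃ B₃' a₀ a₁ (le_refl 3)) h9 hcomp hcompRev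

/-- **★ THE ⁷ K0 BODY AT `θ₁₅ᶜᶜᴹ(3; γ)` FROM THE TWO-SIDED β-BOX OF A1's WITNESS ON `]0, γ]` WITH THE TWO LETTERS, ON EVERY FAMILY** (`bₗ ≤ β₁₃(θ₁₅ᶜᶜᴹ(3)) ≤ β′` on `]0, γ]^{k+1}`,
`−bₗ·γ² ≤ 3`, `β′·γ² ≤ ¾`; NO sign; NO `4 ≤ F.m`) — Eʷ's `…_of_betaBoxSignFree_half_cube` without `hm` (Dʷ §4ʷ ∘ `_cube_allTorus`).  CONDITIONAL; K0⁷ NOT closed here.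
[cite: Balaban1985Variational, Thm 1 (8)–(9) p.279, Prop. 8 p.304; Balaban1988Convergent, Thm 1 p.262, (2.6)–(2.8) pp.255–256, p.257; Balaban1987RG1, Thm 1 p.259, (0.20) p.256, (1.20)–(1.22) p.264, §1 p.264] -/
theorem exists_k0SepCoPH_thm1CCMW_of_gauge9TopStepR_of_betaBoxSignFree_half_cube_allTorus (F : T4Family) (hγ0 : 0 < γ) (hγ : γ ≤ 1 / 2) (hε : 0 < ε₀) (hε' : 0 < ε₂₉)
    (hB : 0 ≤ B₃) (hB' : 0 ≤ B₃') (ha₀ : 0 < a₀) (ha₁ : 0 < a₁) (h15 : VariationalThm1RegSepCoP7MGB F 2 (floorGuard F ((11 * 4 + 3 * F.L) * F.L)) (lamDatum F) (dataSmall7PTopOf F 2) B₃ a₀ a₁)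
    (h9 : Gauge9RegSepTopStepGB F 2 (fun ν K Ω => suppDomOfRecord F ν K Ω) (F.L ^ 3) (floorGuard F ((11 * 4 + 3 * F.L) * F.L)) (lamDatum F) (dataSmall7PTopOf F 2) B₃ B₃' a₀ a₁)
    {bl β' : ℝ} (hlow : BetaLowerH bl γ (betaOfRecord₁₃ F 2 (theta13OfThm1CCM F 2 3 ε₀ ε₂₉ B₃ B₃' a₀ a₁))) (hup : BetaUpperH β' γ (betaOfRecord₁₃ F 2 (theta13OfThm1CCM F 2 3 ε₀ ε₂₉ B₃ B₃' a₀ a₁)))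
    (hl : -bl * γ ^ 2 ≤ 3) (hu : β' * γ ^ 2 ≤ 3 / 4) :
    ∃ θ : Stage13HParams F 2, θ.Provisos₁₃SepCoPH F 2 ∧ (θ.ZhUnity F 2 ∧ θ.SlotsNondegenerate₁₃ F 2) ∧ θ.Admissible F 2 :=
  have H := hcompBoth_theta13OfThm1CCMW_of_betaBoxSignFree_half (F := F) (N := 2) (j := 3) (ε₀ := ε₀) (ε₂₉ := ε₂₉) (B₃ := B₃) (B₃' := B₃') (a₀ := a₀) (a₁ := a₁)
    hγ hB hB' ha₀.le ha₁.le hlow hup hl hu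
  exists_k0SepCoPH_thm1CCMW_of_gauge9TopStepR_of_hcomp_cube_allTorus F hγ0 hγ hε hε' hB hB' ha₀ ha₁ h15 h9 H.1 H.2

end ClosersGaugeRWHAllTorus

end Literature.MathematicalPhysics.QuantumFieldTheory.Balaban1983to89.Node00

end
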